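import Summits.QuantumFields.YangMills.Theorems.UnitScaleTiltProp7LocMinOfGaugedRowsKD
import Summits.QuantumFields.YangMills.Theorems.UnitScaleTiltProp7JointRowOfSuppliers
import HarnessLib

/-!
# Route `UnitScaleTilt`, crux K1 child «MinimiserStabilityRegPr» (stmt-QuantumFields-19200) — THE FINAL GROWTH-SIDE DOOR OF THE UNTWISTED CLOSURE (OWNER RULING g27-№8):
# E′ ⇐ per competitor {CHART `‖D‖ ≤ s₀ℓ⁻¹`, UNTWISTED membership `e^{iD}W ∈ 𝔅_k(V)`, HESS `κ₀ℓ⁻²M ≤ K` (K-only), CRUDE SLICE `DIV ≤ ζK + δ₁ℓ⁻²M`} —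
# the JOINT remainder row mod coarse gauge is DISCHARGED by ★w4-19200's ✓`Prop7JointRowOfSuppliers.jointRow_of_suppliers` (the (n3) chain F0–F5)

Cell `ym3-torus` ∕ fleet seat `ym-ust-19200-p1` (gen 14, route-R lead ∕ (n3) namer).  THEOREMS ONLY (0 `def`, 0 `sorry`); `--supports stmt-QuantumFields-19200`, count-neutral.
YM₃ on T³ is a ladder rung (R3), not the Clay problem; nothing here claims the stub, the crux, d = 4 or the mass gap; E′ is NOT closed by this file.

WHY.  The (n3) JOINT remainder row of [Balaban1985Variational] (47)–(48)∕(80) — the `ℓ¹` second-order remainder of the `(K−n)`-fold (0.4)-average on the fibre, MOD COARSE PURE GAUGE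
(this seat's conserved-current shortcut, ✓`Prop7LocMinOfGaugedRows`) — is a THEOREM for every chart point `e^{iD}W` on the untwisted fibre of an R2-critical `W ∈ (6)(e)`:
✓`jointRow_of_suppliers` (★w4-19200 g5; over ✓`…FibreLogRatioGaugedL1` (★routeR-w6), ✓`…LogRemainderMass` (★routeR-w3), ✓`…FibreLevelMassPerLevelT3`∕✓`…JointRowOfLevelMasses`
(★routeR-w6), ✓`…TrueLinReality(Families)` (★routeR-w2)), in `(K + DIV)` currency with `L`-only constants `C₁(L) = 2A₁ + 322608A₂`, `C₂(L) = 8A₂`,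
`A₁ = (3∕2)(694800L⁵)(7L²∕(L−1) + 600000L⁴·L²∕(L³−1))`, `A₂ = (3∕2)(694800L⁵)(28800L⁴)(L²∕(L³−1))`, windows `10¹⁴L⁹e ≤ 1`, `4·10¹¹L⁹(ℓs) ≤ 1`.  Plugged into door v4
(✓`Prop7LocMinOfGaugedRowsKD.stub_PV3E_of_gaugedRowsKD`) it removes the JOINT conjunct: the E′ text follows from ONE uniform hypothesis displaying per competitor ONLY the chart with
its untwisted membership, the K-only HESS row and a crude divergence budget, with `L`-only constants `e₆, s₀, κ₀, ζ, δ₁` and windows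
`10¹⁴L⁹e₆ ≤ 1`, `4s₀ ≤ 1`, `4·10¹¹L⁹s₀ ≤ 1`, `16e₆C₂(L)(1+ζ) ≤ 1`, `15552s₀² + 216e₆ + 2e₆(C₁(L) + C₂(L)δ₁) ≤ κ₀∕8`.

WHAT IS PROVED (ns `…Theorems.Prop7LocMinOfChartSliceHess`): ★★★ `stub_PV3E_of_chartSliceHess`.
HONEST SCOPE.  Bookkeeping over landed theorems; no new analytic content.  DISPLAYED per competitor, not proved: (i) CHART + UNTWISTED membership — the re-gauged [Balaban1985RegularSpaces]
Thm-2 representative (✓`Prop7BlendPrescribed`, ✓`Prop7TwistRegauge`; corner data ★w1-19200 g11); (ii) HESS in K-only currency for that representative — route-R's registered stub P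
(relative∕pinned Poincaré on the fibre; flat ✓`sum_normSq_le_curl_normSq_of_pinned`, curved (JC) OPEN); (iii) the crude slice (★routeR-w3's LEMMA (S_blk-DIV) + the blend's
Laplacian row; constants of any size).  The (116)-currency doors ✓`Prop7LocMinOfGaugedRows116(Text)` remain correct but their slice window `δ₀ < 4κ_H` is not met by (i)'s
representative (bus 2026-08-28 16:26Z∕16:29Z).

References: T. Bałaban, CMP 102 (1985) 277–309 [Balaban1985Variational] ((4)–(7) p.278, (14) p.280, (47)–(48) pp.285–286, (80) p.290, (116) p.295, (141)–(143), Prop. 7 p.299);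
CMP 99 (1985) 389–434 [Balaban1985BackgroundPropagators] ((3.9)–(3.11) p.392, (3.118)–(3.122) pp.419–420, Thm 3.11 p.416); CMP 99 (1985) 75–102 [Balaban1985RegularSpaces]
((1.29)–(1.30) p.81, (1.38) p.82, Thm 2 p.83); CMP 98 (1985) 17–51 [Balaban1985Averaging] ((11) p.19, (122)–(126) p.36).
-/

set_option autoImplicit false
noncomputable section

open scoped BigOperators Matrix.Norms.L2Operator Matrix Topology
open Filter

namespace Summit.QuantumFields.YangMills.Theorems.Prop7LocMinOfChartSliceHess

open Literature.MathematicalPhysics.QuantumFieldTheory.Balaban1983to89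
open Literature.MathematicalPhysics.QuantumFieldTheory.Balaban1983to89.T3ContinuumYM3Torus
open Literature.MathematicalPhysics.QuantumFieldTheory.Balaban1983to89.T3UnitLawDensityEML (ℰp)
open Literature.MathematicalPhysics.QuantumFieldTheory.Balaban1983to89.T3ConstrainedMinimiser
open Literature.MathematicalPhysics.QuantumFieldTheory.Balaban1983to89.T3Thm1Carrier
open Literature.MathematicalPhysics.QuantumFieldTheory.Balaban1983to89.T3PrintedRegularMinimiser
open Literature.MathematicalPhysics.QuantumFieldTheory.Balaban1983to89.T3RegularMinimiser
open Literature.MathematicalPhysics.QuantumFieldTheory.Balaban1983to89.T3Thm1CarrierNative (IsCritR2)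
open Literature.MathematicalPhysics.QuantumFieldTheory.Balaban1983to89.T3SectALandauChart (emb15 CloseAvg pos_of_regPr)
open T4Continuum BlockAveraging AveragingRT ExpMeanLog BlockAveragingEMLLinearised BlockAveragingEMLLinearisedBackground BlockAveragingEMLProp2
open Summit.QuantumFields.YangMills.Theorems.Prop7TPrint (expHermField)
open Summit.QuantumFields.YangMills.Theorems.Prop7LocMinOfJointRow (isMinOn_regFibrePr_of_linRows_at linRow_of_QRows)
open Summit.QuantumFields.YangMills.Theorems.Prop7FirstVariationExactPairing (abs_lin_le_sum_norm_trueLinIter tower_loop_rows_of_regPr gaugeDir_mem_su2)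
open Summit.QuantumFields.YangMills.Theorems.Prop7CurvedLandauRowA (exists_trueLinIter_family)
open Summit.QuantumFields.YangMills.Theorems.Prop7LocMinOfMultiplierRows (I_smul_mem_skewAdjoint trace_I_smul_eq_zero scaled_smallness_mult)
open Summit.QuantumFields.YangMills.Theorems.Prop7TrueLinPureGaugeIter (trueLinIter_sub trueLinIter_pureGauge)
open Summit.QuantumFields.YangMills.Theorems.Prop7LinGaugeInvariance (lin_sub_gaugeDir_eq)
open Summit.QuantumFields.YangMills.Theorems.Prop7LocMinOfGaugedRowsKD (stub_PV3E_of_gaugedRowsKD)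
open Summit.QuantumFields.YangMills.Theorems.Prop7JointRowOfSuppliers (jointRow_of_suppliers)
open Literature.MathematicalPhysics.QuantumFieldTheory.Balaban1983to89.T3ConstrainedMinimiser (fibre)
open B9Eq39Adjoint (divB)
open B9TorusCalculus (torusT)
open B10Eq27TorusAxialLog (unitsField toUField)
open B15DeterminingSets (embIter)
open B5Eq118OneStroke (iterBlockOf)
open Node00 (iterBlockOf_embIter_eq)

/-! ## ★★★ The final growth-side door -/

set_option maxHeartbeats 400000 in
/-- ★★★ **ROW E′ FROM {CHART + UNTWISTED MEMBERSHIP, K-ONLY HESS, CRUDE SLICE} — JOINT DISCHARGED.**  For every `L > 1` constants `e₆ > 0` (`10¹⁴L⁹e₆ ≤ 1`), `s₀ ≥ 0`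
(`4s₀ ≤ 1`, `4·10¹¹L⁹s₀ ≤ 1`), `κ₀`, `ζ`, `δ₁ ≥ 0` with `16e₆C₂(L)(1+ζ) ≤ 1`, `15552s₀² + 216e₆ + 2e₆(C₁(L) + C₂(L)δ₁) ≤ κ₀∕8` (`C₁(L), C₂(L)` = the explicit constants of
✓`jointRow_of_suppliers`, written out) such that at every member, radius `0 < e ≤ e₆`, datum `V`, R2-critical `W ∈ (6)(e) ∩ 𝔅_k(V)`, every competitor `W′ ∈ (6)(e) ∩ 𝔅_k(V)` has
a Hermitian-traceless `D` with `‖D b‖ ≤ s₀ℓ⁻¹`, `A(W′) = A(e^{iD}W)`, `e^{iD}W ∈ 𝔅_k(V)`, HESS `κ₀ℓ⁻²Σ‖D‖² ≤ Σ_p‖ℒ_p(D)‖²` and the crude slice `DIV ≤ ζK + δ₁ℓ⁻²M`.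
CONCLUSION = the E′ text verbatim (`e₅ := e₆`, `a₁'' := 1`).  Proof: door v4 with its JOINT conjunct supplied, for every recursion family `Q`, by ✓`jointRow_of_suppliers`.
[cite: Balaban1985Variational, (141)-(143) p.299, Prop. 7 p.299, (47)-(48) pp.285-286, (80) p.290, (116) p.295, (14) p.280, (4)-(7) p.278; Balaban1985BackgroundPropagators, (3.9)-(3.11) p.392; Balaban1985Averaging, (122)-(126) p.36] -/
theorem stub_PV3E_of_chartSliceHess
    (hrowsU : ∀ (L : ℕ), 1 < L → ∃ e₆ s₀ κ₀ ζ δ₁ : ℝ, 0 < e₆ ∧ 100000000000000 * (L : ℝ) ^ 9 * e₆ ≤ 1 ∧ 0 ≤ s₀ ∧ 4 * s₀ ≤ 1 ∧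
      400000000000 * (L : ℝ) ^ 9 * s₀ ≤ 1 ∧ 0 ≤ δ₁ ∧
      16 * e₆ * ((8 * ((3 / 2) * (694800 * (L : ℝ) ^ 5) * (28800 * (L : ℝ) ^ 4) * ((L : ℝ) ^ 2 / ((L : ℝ) ^ 3 - 1)))) * (1 + ζ)) ≤ 1 ∧
      15552 * s₀ ^ 2 + 216 * e₆ + 2 * e₆ * ((2 * ((3 / 2) * (694800 * (L : ℝ) ^ 5) * (7 * ((L : ℝ) ^ 2 / ((L : ℝ) - 1)) + 600000 * (L : ℝ) ^ 4 * ((L : ℝ) ^ 2 / ((L : ℝ) ^ 3 - 1)))) + 322608 * ((3 / 2) * (694800 * (L : ℝ) ^ 5) * (28800 * (L : ℝ) ^ 4) * ((L : ℝ) ^ 2 / ((L : ℝ) ^ 3 - 1))))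
        + (8 * ((3 / 2) * (694800 * (L : ℝ) ^ 5) * (28800 * (L : ℝ) ^ 4) * ((L : ℝ) ^ 2 / ((L : ℝ) ^ 3 - 1)))) * δ₁) ≤ κ₀ / 8 ∧
      ∀ (F : T3Family), F.L = L → ∀ (n K : ℕ) (hnK : n < K) (e : ℝ) (V : GaugeField (F.P n) 0 (Matrix.specialUnitaryGroup (Fin 2) ℂ))
        (W : GaugeField (F.P K) 0 (Matrix.specialUnitaryGroup (Fin 2) ℂ)),
        0 < e → e ≤ e₆ → W ∈ regFibrePr F n K hnK.le e V → IsCritR2 F n K hnK.le V W →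
        ∀ W' : GaugeField (F.P K) 0 (Matrix.specialUnitaryGroup (Fin 2) ℂ), W' ∈ regFibrePr F n K hnK.le e V →
          ∃ (D : PBond (F.P K) 0 → Matrix (Fin 2) (Fin 2) ℂ),
            (∀ b : PBond (F.P K) 0, (D b).IsHermitian ∧ Matrix.trace (D b) = 0) ∧ (∀ b : PBond (F.P K) 0, ‖D b‖ ≤ s₀ * ((F.L : ℝ) ^ (K - n))⁻¹) ∧
            wilsonAction4 W' = wilsonAction4 (emb15 W (expHermField D)) ∧
            emb15 W (expHermField D) ∈ fibre F ℰp n K hnK.le V ∧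
            κ₀ * (((F.L : ℝ) ^ (K - n)) ^ 2)⁻¹ * ∑ b : PBond (F.P K) 0, ‖D b‖ ^ 2
              ≤ ∑ p : Plaq (F.P K) 0, ‖((Complex.I • D ⟨p.src, p.μ⟩) + ((W ⟨p.src, p.μ⟩ : Matrix (Fin 2) (Fin 2) ℂ) * (Complex.I • D ⟨p.src.shift p.μ, p.ν⟩) * star (W ⟨p.src, p.μ⟩ : Matrix (Fin 2) (Fin 2) ℂ))
            - (((W ⟨p.src, p.μ⟩ * W ⟨p.src.shift p.μ, p.ν⟩ * (W ⟨p.src.shift p.ν, p.μ⟩)⁻¹ : Matrix.specialUnitaryGroup (Fin 2) ℂ) : Matrix (Fin 2) (Fin 2) ℂ) * (Complex.I • D ⟨p.src.shift p.ν, p.μ⟩) * star ((W ⟨p.src, p.μ⟩ * W ⟨p.src.shift p.μ, p.ν⟩ * (W ⟨p.src.shift p.ν, p.μ⟩)⁻¹ : Matrix.specialUnitaryGroup (Fin 2) ℂ) : Matrix (Fin 2) (Fin 2) ℂ))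
            - (((GaugeField.plaqHol W p : Matrix.specialUnitaryGroup (Fin 2) ℂ) : Matrix (Fin 2) (Fin 2) ℂ) * (Complex.I • D ⟨p.src, p.ν⟩) * star ((GaugeField.plaqHol W p : Matrix.specialUnitaryGroup (Fin 2) ℂ) : Matrix (Fin 2) (Fin 2) ℂ)))‖ ^ 2 ∧
            (∑ x : Site (F.P K) 0, ∑ j : Fin 2, ∑ k : Fin 2,
            ‖(divB (torusT (F.P K) 0) (fun κ z => unitsField (toUField W) ⟨z, κ⟩) (fun κ z => Complex.I • D ⟨z, κ⟩) x) j k‖ ^ 2)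
              ≤ ζ * (∑ p : Plaq (F.P K) 0, ‖((Complex.I • D ⟨p.src, p.μ⟩) + ((W ⟨p.src, p.μ⟩ : Matrix (Fin 2) (Fin 2) ℂ) * (Complex.I • D ⟨p.src.shift p.μ, p.ν⟩) * star (W ⟨p.src, p.μ⟩ : Matrix (Fin 2) (Fin 2) ℂ))
            - (((W ⟨p.src, p.μ⟩ * W ⟨p.src.shift p.μ, p.ν⟩ * (W ⟨p.src.shift p.ν, p.μ⟩)⁻¹ : Matrix.specialUnitaryGroup (Fin 2) ℂ) : Matrix (Fin 2) (Fin 2) ℂ) * (Complex.I • D ⟨p.src.shift p.ν, p.μ⟩) * star ((W ⟨p.src, p.μ⟩ * W ⟨p.src.shift p.μ, p.ν⟩ * (W ⟨p.src.shift p.ν, p.μ⟩)⁻¹ : Matrix.specialUnitaryGroup (Fin 2) ℂ) : Matrix (Fin 2) (Fin 2) ℂ))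
            - (((GaugeField.plaqHol W p : Matrix.specialUnitaryGroup (Fin 2) ℂ) : Matrix (Fin 2) (Fin 2) ℂ) * (Complex.I • D ⟨p.src, p.ν⟩) * star ((GaugeField.plaqHol W p : Matrix.specialUnitaryGroup (Fin 2) ℂ) : Matrix (Fin 2) (Fin 2) ℂ)))‖ ^ 2)
                + δ₁ * (((F.L : ℝ) ^ (K - n)) ^ 2)⁻¹ * ∑ b : PBond (F.P K) 0, ‖D b‖ ^ 2) :
    ∀ (L : ℕ), 1 < L → ∀ (B₃ : ℝ), 4 < B₃ →
    ∃ e₅ a₁'' : ℝ, 0 < e₅ ∧ 0 < a₁'' ∧ ∀ (i : Idx L) (e ε₁ : ℝ) (V : GaugeField (i.1.1.P i.1.2.1) 0 (Matrix.specialUnitaryGroup (Fin 2) ℂ))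
      (U₀ W : GaugeField (i.1.1.P i.1.2.2) 0 (Matrix.specialUnitaryGroup (Fin 2) ℂ)),
      0 < ε₁ → ε₁ ≤ a₁'' → PlaqSmall ε₁ V → (L : ℝ) ^ 3 * B₃ * ε₁ ≤ e → e ≤ e₅ →
      RegPr i.1.1 i.1.2.1 i.1.2.2 ((L : ℝ) ^ 3 * B₃ * ε₁) U₀ → CloseAvg i.1.1 i.1.2.1 i.1.2.2 i.2.2.le ((L : ℝ) ^ 3 * ε₁) V U₀ →
      W ∈ regFibrePr i.1.1 i.1.2.1 i.1.2.2 i.2.2.le e V → IsCritR2 i.1.1 i.1.2.1 i.1.2.2 i.2.2.le V W →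
        IsMinOn (fun W' : GaugeField (i.1.1.P i.1.2.2) 0 (Matrix.specialUnitaryGroup (Fin 2) ℂ) => wilsonAction4 W')
          (regFibrePr i.1.1 i.1.2.1 i.1.2.2 i.2.2.le e V) W := by
  intro L hL B₃ hB₃
  refine stub_PV3E_of_gaugedRowsKD ?_ L hL B₃ hB₃
  intro L' hL'
  -- door v4's uniform hypothesis at every `L′`, supplied from `hrowsU` with F5's constants
  obtain ⟨e₆', s₀', κ₀', ζ', δ₁', he₆', he₆L'', hs₀', hs₀4', hs₀L', hδ₁', hC₂e', hsmall', H'⟩ := hrowsU L' hL'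
  have hL1r' : (1 : ℝ) < (L' : ℝ) := by exact_mod_cast hL'
  have hL0r' : (0 : ℝ) < (L' : ℝ) := by linarith
  have hd1' : (0 : ℝ) < (L' : ℝ) - 1 := by linarith
  have hd3' : (0 : ℝ) < (L' : ℝ) ^ 3 - 1 := by nlinarith [hL1r', pow_pos hL0r' 2]
  have hq1' : (0 : ℝ) ≤ (L' : ℝ) ^ 2 / ((L' : ℝ) - 1) := (div_pos (by positivity) hd1').le
  have hq3' : (0 : ℝ) ≤ (L' : ℝ) ^ 2 / ((L' : ℝ) ^ 3 - 1) := (div_pos (by positivity) hd3').le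
  have hA₂' : (0 : ℝ) ≤ (3 / 2) * (694800 * (L' : ℝ) ^ 5) * (28800 * (L' : ℝ) ^ 4) * ((L' : ℝ) ^ 2 / ((L' : ℝ) ^ 3 - 1)) :=
    mul_nonneg (mul_nonneg (mul_nonneg (by norm_num) (by positivity)) (by positivity)) hq3'
  have hA₁' : (0 : ℝ) ≤ (3 / 2) * (694800 * (L' : ℝ) ^ 5) * (7 * ((L' : ℝ) ^ 2 / ((L' : ℝ) - 1)) + 600000 * (L' : ℝ) ^ 4 * ((L' : ℝ) ^ 2 / ((L' : ℝ) ^ 3 - 1))) :=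
    mul_nonneg (mul_nonneg (by norm_num) (by positivity)) (add_nonneg (mul_nonneg (by norm_num) hq1') (mul_nonneg (mul_nonneg (by norm_num) (by positivity)) hq3'))
  have he₆L''' : 10 ^ 10 * (L' : ℝ) ^ 6 * e₆' ≤ 1 := by
    have hmono : (10 : ℝ) ^ 10 * (L' : ℝ) ^ 6 ≤ 100000000000000 * (L' : ℝ) ^ 9 := by
      have h6 : (L' : ℝ) ^ 6 ≤ (L' : ℝ) ^ 9 := pow_le_pow_right₀ hL1r'.le (by norm_num)
      have h6' : (0 : ℝ) ≤ (L' : ℝ) ^ 6 := by positivity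
      nlinarith
    exact (mul_le_mul_of_nonneg_right hmono he₆'.le).trans he₆L''
  refine ⟨e₆', s₀', κ₀', ζ', δ₁', _, _, he₆', he₆L''', hs₀', hs₀4', hδ₁',
    add_nonneg (mul_nonneg (by norm_num) hA₁') (mul_nonneg (by norm_num) hA₂'), mul_nonneg (by norm_num) hA₂', hC₂e', hsmall', ?_⟩
  intro F hF n K hnK e V W he hhi hW hWcrit Q hQ0 hQs W' hW'
  obtain ⟨D, hDh, hDs, hA, hfibD, hq, hsl⟩ := H' F hF n K hnK e V W he hhi hW hWcrit W' hW'
  -- ★w4's F5: the JOINT row mod coarse gauge for this competitor, in `(K + DIV)` currency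
  have hFL : (F.L : ℝ) = (L' : ℝ) := by exact_mod_cast hF
  have hL1 : (1 : ℝ) ≤ (F.L : ℝ) := by rw [hFL]; exact hL1r'.le
  set ℓ : ℝ := (F.L : ℝ) ^ (K - n) with hℓ
  have hℓ1 : (1 : ℝ) ≤ ℓ := one_le_pow₀ hL1
  have hℓ0 : (0 : ℝ) < ℓ := by linarith
  have heL : 100000000000000 * (F.L : ℝ) ^ 9 * e ≤ 1 := by
    rw [hFL]
    have : 100000000000000 * (L' : ℝ) ^ 9 * e ≤ 100000000000000 * (L' : ℝ) ^ 9 * e₆' := mul_le_mul_of_nonneg_left hhi (by positivity)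
    exact this.trans he₆L''
  have hs0 : 0 ≤ s₀' * ℓ⁻¹ := by positivity
  have hs4 : 4 * (s₀' * ℓ⁻¹) ≤ 1 := by
    have hi : ℓ⁻¹ ≤ 1 := inv_le_one_of_one_le₀ hℓ1
    nlinarith [mul_le_mul_of_nonneg_left hi hs₀']
  have hsL : 400000000000 * (F.L : ℝ) ^ 9 * (ℓ * (s₀' * ℓ⁻¹)) ≤ 1 := by
    rw [show ℓ * (s₀' * ℓ⁻¹) = s₀' by field_simp, hFL]
    exact hs₀L'
  have hJ := jointRow_of_suppliers F hnK.le he heL hs0 hs4 hsL V hW Q hQ0 hQs D hDh hDs hfibD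
  -- read F5's `L`-only constants at this member (`F.L = L′`), leaving `ℓ = F.L^{K−n}` untouched
  have hC1eq : (2 * ((3 / 2) * (694800 * (F.L : ℝ) ^ 5) * (7 * ((F.L : ℝ) ^ 2 / ((F.L : ℝ) - 1)) + 600000 * (F.L : ℝ) ^ 4 * ((F.L : ℝ) ^ 2 / ((F.L : ℝ) ^ 3 - 1))))
      + 322608 * ((3 / 2) * (694800 * (F.L : ℝ) ^ 5) * (28800 * (F.L : ℝ) ^ 4) * ((F.L : ℝ) ^ 2 / ((F.L : ℝ) ^ 3 - 1))))
      = (2 * ((3 / 2) * (694800 * (L' : ℝ) ^ 5) * (7 * ((L' : ℝ) ^ 2 / ((L' : ℝ) - 1)) + 600000 * (L' : ℝ) ^ 4 * ((L' : ℝ) ^ 2 / ((L' : ℝ) ^ 3 - 1))))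
      + 322608 * ((3 / 2) * (694800 * (L' : ℝ) ^ 5) * (28800 * (L' : ℝ) ^ 4) * ((L' : ℝ) ^ 2 / ((L' : ℝ) ^ 3 - 1)))) := by rw [hFL]
  have hC2eq : (8 * ((3 / 2) * (694800 * (F.L : ℝ) ^ 5) * (28800 * (F.L : ℝ) ^ 4) * ((F.L : ℝ) ^ 2 / ((F.L : ℝ) ^ 3 - 1))))
      = (8 * ((3 / 2) * (694800 * (L' : ℝ) ^ 5) * (28800 * (L' : ℝ) ^ 4) * ((L' : ℝ) ^ 2 / ((L' : ℝ) ^ 3 - 1)))) := by rw [hFL]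
  rw [hC1eq, hC2eq] at hJ
  exact ⟨D, hDh, hDs, hA, hq, hsl, hJ⟩

end Summit.QuantumFields.YangMills.Theorems.Prop7LocMinOfChartSliceHess

end
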